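import Literature.Geometry.Lorentzian.KerrRedShiftEstimate
import HarnessLib

/-!
# Route ClusterCompleteness — crux `AdiabaticMultiKerrILED`, line `Sketch`: local red-shift
# estimate, part 1/3 (the pointwise divergence bound; exhaustion by receding parameters)

Helper file for the crux `stmt-FinalStateConjecture-14310`
(`Summit.FinalStateConjecture.FinalStateConjecture.Theses.ClusterCompleteness.AdiabaticMultiKerrILED`),
serving the stub `stub_redShiftLocal` of line `Sketch` (the red-shift estimate of
Dafermos–Rodnianski–Shlapentokh-Rothman arXiv:1402.7034, Prop. 4.5.2 / §13.2, between graph leaves,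
with the wave equation assumed only locally). Two self-contained blocks of the proofs of
`Literature.Geometry.Lorentzian.Kerr.redShift_weighted_estimate` / `Kerr.redShift_estimate` are
factored here, verbatim up to plumbing:

* `redShift_weightedCurrent_divergence_le` — the divergence of the weighted current
  `W_ε (−J^N + ε₀ J^{dt*})[Φ]` at an exterior point `x` where `□Φ(x) = 0`: it is
  `χ (dσ·(−J^N + ε₀J^{dt*})) + σ (dχ·(…)) + W_ε(−K^N + ε₀ R)`, the first term `≤ 0`
  (`Kerr.redShift_horizonFactor_flux`, `Kerr.horizonFactor_flux`), the second
  `≤ 4 C_J (∑|∂χ|) ∑(∂Φ)²`, the third `≤ −(b/2) W_ε ∑(∂Φ)²` (coercivity of `K^N`,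
  `abs_deformationTerm_le`). The equation is used at the single point `x` only — this is what makes
  the local version of the estimate possible.
* `redShift_lintegral_exhaustion` — the monotone-convergence tail of `Kerr.redShift_estimate`:
  an `[0, ∞]`-bound for the leaf-plus-bulk integrals over `{2/(n+1) ≤ h, r ≤ R₁}` uniform in `n`
  passes to `{0 < h, r ≤ R₁}` (`lintegral_iSup` in `y` and in `u`).
-/

noncomputable section

-- the doubled `FinalStateConjecture.FinalStateConjecture` path component trips dupNamespace
set_option linter.dupNamespace false

open Set Filter Metric MeasureTheory
open scoped Topology ENNReal
open Literature.Geometry.Lorentzian Literature.Geometry.Lorentzian.Kerr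

namespace Summit.FinalStateConjecture.FinalStateConjecture.Cruxes.AdiabaticMultiKerrILED.Sketch

/-- **Divergence of the weighted red-shift current at a point where the wave equation holds**
(the block `hdiv` of `Kerr.redShift_weighted_estimate`, DRSR arXiv:1402.7034, proof of Prop. 4.5.2):
at an exterior point `x` with `□_B Φ(x) = 0` (`B` the surgered background), `N` timelike with
`N⁰ ≥ 0` at `x`, coercive bulk `b₁ ∑(∂Φ)² ≤ K^N[Φ](x)`, `|∂B⁻¹| ≤ D`, `ε₀ · 32(1 + ‖B‖)D ≤ b₁/2`
and the current bound `|−J^N_μ + ε₀ J^{dt*}_μ| ≤ C_J ∑(∂Φ)²`, the divergence of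
`W_ε (−J^N + ε₀ J^{dt*})` at `x` is at most `−(b₁/2) W_ε ∑(∂Φ)² + 4 C_J (∑_μ |∂_μχ|) ∑(∂Φ)².
[cite: DafermosRodnianskiShlapentokhrothman2014, Prop. 4.5.2 and §13.2] -/
theorem redShift_weightedCurrent_divergence_le {M a : ℝ} (hMa : Kerr.IsSubextremal M a)
    {hp ε ε₀ R₁ R₂ b₁ CJ D : ℝ} (hp0 : 0 < hp) (hε : 0 < ε) (hε₀pos : 0 < ε₀) (hR₁pos : 0 < R₁)
    (hR12 : R₁ < R₂) (hCJ0 : 0 ≤ CJ) (hD0 : 0 ≤ D)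
    (hD : ∀ (x : E4) (μ α β : Fin 4), |fderiv ℝ (fun z ↦
      (Kerr.surgeryBackground M a (Kerr.rPlus M a) hMa.pos.le hMa.rPlus_pos).inverseMetric z α β) x
        (E4.basisVector μ)| ≤ D)
    (hε₀D : ε₀ * (32 * (1 + (Kerr.surgeryBackground M a (Kerr.rPlus M a) hMa.pos.le
      hMa.rPlus_pos).bound) * D) ≤ b₁ / 2)
    {Φ : E4 → ℝ} {x : E4} (hΦ : ContDiffAt ℝ 2 Φ x) (hxr : Kerr.rPlus M a < Kerr.radius a x)
    (hsol : KerrSchild.waveOperator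
      (Kerr.surgeryBackground M a (Kerr.rPlus M a) hMa.pos.le hMa.rPlus_pos).inverseMetric Φ x = 0)
    (hNN : Kerr.bilin M a x (Kerr.redShiftVec M a hp hp x) (Kerr.redShiftVec M a hp hp x) < 0)
    (hN0 : 0 ≤ Kerr.redShiftVec M a hp hp x 0)
    (hcoer : b₁ * ∑ μ, fderiv ℝ Φ x (E4.basisVector μ) ^ 2 ≤
      KerrSchild.multiplierBulk (Kerr.inverseMetric M a) (Kerr.redShiftVector M a hp hp) Φ x)
    (hCurK : ∀ μ, |-KerrSchild.multiplierCurrent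
        (Kerr.surgeryBackground M a (Kerr.rPlus M a) hMa.pos.le hMa.rPlus_pos).inverseMetric
        (Kerr.redShiftVector M a hp hp) Φ x μ + ε₀ * KerrSchild.normalCurrent
          (Kerr.surgeryBackground M a (Kerr.rPlus M a) hMa.pos.le hMa.rPlus_pos).inverseMetric
          Φ x μ| ≤ CJ * ∑ μ, fderiv ℝ Φ x (E4.basisVector μ) ^ 2) :
    ∑ μ, fderiv ℝ (fun y ↦ Kerr.redShiftWeight M a R₁ R₂ ε y *
        (-KerrSchild.multiplierCurrent
          (Kerr.surgeryBackground M a (Kerr.rPlus M a) hMa.pos.le hMa.rPlus_pos).inverseMetric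
          (Kerr.redShiftVector M a hp hp) Φ y μ + ε₀ * KerrSchild.normalCurrent
            (Kerr.surgeryBackground M a (Kerr.rPlus M a) hMa.pos.le hMa.rPlus_pos).inverseMetric
            Φ y μ)) x (E4.basisVector μ) ≤
      -(b₁ / 2 * (Kerr.redShiftWeight M a R₁ R₂ ε x * ∑ μ, fderiv ℝ Φ x (E4.basisVector μ) ^ 2)) +
        4 * CJ * ((∑ μ, |fderiv ℝ (Kerr.collarCutoff a R₁ R₂) x (E4.basisVector μ)|) *
          ∑ μ, fderiv ℝ Φ x (E4.basisVector μ) ^ 2) := by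
  have hrp : 0 < rPlus M a := hMa.rPlus_pos
  have hxpos : 0 < radius a x := hrp.trans hxr
  -- ### notation
  set B := surgeryBackground M a (rPlus M a) hMa.pos.le hMa.rPlus_pos with hB
  set G := B.inverseMetric with hG
  set N : E4 → Fin 4 → ℝ := redShiftVector M a hp hp with hN
  set χ : E4 → ℝ := collarCutoff a R₁ R₂ with hχ
  set hf : E4 → ℝ := fun y ↦ Real.smoothTransition (horizonFn M a y / ε - 1) with hhf
  set W : E4 → ℝ := redShiftWeight M a R₁ R₂ ε with hW
  set p2 : E4 → ℝ := fun x ↦ ∑ μ, fderiv ℝ Φ x (E4.basisVector μ) ^ 2 with hp2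
  set JN : Fin 4 → E4 → ℝ := fun μ x ↦ KerrSchild.multiplierCurrent G N Φ x μ with hJN
  set P : Fin 4 → E4 → ℝ := fun μ x ↦ KerrSchild.normalCurrent G Φ x μ with hP
  set Cur : Fin 4 → E4 → ℝ := fun μ x ↦ -JN μ x + ε₀ * P μ x with hCur
  set J : Fin 4 → E4 → ℝ := fun μ x ↦ W x * Cur μ x with hJ
  set V : E4 → ℝ := fun x ↦ ∑ μ, |fderiv ℝ χ x (E4.basisVector μ)| with hV
  set ℓ : E4 → ℝ := fun x ↦ b₁ / 2 * (W x * p2 x) with hℓ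
  set e : E4 → ℝ := fun x ↦ 4 * CJ * (V x * p2 x) with he
  show ∑ μ, fderiv ℝ (J μ) x (E4.basisVector μ) ≤ -ℓ x + e x
  have hCurK' : ∀ μ, |Cur μ x| ≤ CJ * p2 x := hCurK
  have hp2nn : 0 ≤ p2 x := Finset.sum_nonneg fun μ _ ↦ sq_nonneg _
  have hWdef : ∀ x, W x = χ x * hf x := fun x ↦ rfl
  have hW1 : ContDiff ℝ 1 W := contDiff_redShiftWeight hR₁pos hR12 hrp hε
  have hW0 : 0 ≤ W x := redShiftWeight_nonneg M a R₁ R₂ ε x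
  have hχ1 : ContDiff ℝ 1 χ := contDiff_collarCutoff hR₁pos hR12
  have hhf1 : ContDiff ℝ 1 hf := contDiff_horizonFactor hrp hε
  have hχ0 : 0 ≤ χ x := collarCutoff_nonneg a R₁ R₂ x
  have hhf0 : 0 ≤ hf x := Real.smoothTransition.nonneg _
  have hhfle : hf x ≤ 1 := Real.smoothTransition.le_one _
  have hV0 : 0 ≤ V x := Finset.sum_nonneg fun μ _ ↦ abs_nonneg _
  -- ### regularity of the currents at `x`
  have hP1 : ∀ μ, ContDiffAt ℝ 1 (P μ) x := fun μ ↦ B.contDiffAt_normalCurrent hΦ μ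
  have hJN1 : ∀ μ, ContDiffAt ℝ 1 (JN μ) x := fun μ ↦
    contDiffAt_redShiftCurrent hMa hp hp hΦ hxpos μ
  have hCur1 : ∀ μ, ContDiffAt ℝ 1 (Cur μ) x := fun μ ↦
    (hJN1 μ).neg.add (contDiffAt_const.mul (hP1 μ))
  -- differentiability
  have hWd : DifferentiableAt ℝ W x := (hW1.differentiable one_ne_zero) x
  have hχd : DifferentiableAt ℝ χ x := (hχ1.differentiable one_ne_zero) x
  have hhfd : DifferentiableAt ℝ hf x := (hhf1.differentiable one_ne_zero) x
  have hJNd : ∀ μ, DifferentiableAt ℝ (JN μ) x := fun μ ↦ (hJN1 μ).differentiableAt one_ne_zero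
  have hPd : ∀ μ, DifferentiableAt ℝ (P μ) x := fun μ ↦ (hP1 μ).differentiableAt one_ne_zero
  have hCurd : ∀ μ, DifferentiableAt ℝ (Cur μ) x := fun μ ↦
    (hCur1 μ).differentiableAt one_ne_zero
  -- product rules
  have hdW : ∀ κ, fderiv ℝ W x (E4.basisVector κ) =
      fderiv ℝ χ x (E4.basisVector κ) * hf x + χ x * fderiv ℝ hf x (E4.basisVector κ) := by
    intro κ
    have : W = fun y ↦ χ y * hf y := rfl
    rw [this, fderiv_fun_mul hχd hhfd]
    simp only [add_apply, FunLike.coe_smul, Pi.smul_apply, smul_eq_mul]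
    ring
  have hdJ : ∀ μ κ, fderiv ℝ (J μ) x (E4.basisVector κ) =
      fderiv ℝ W x (E4.basisVector κ) * Cur μ x + W x * fderiv ℝ (Cur μ) x (E4.basisVector κ) := by
    intro μ κ
    have : J μ = fun y ↦ W y * Cur μ y := rfl
    rw [this, fderiv_fun_mul hWd (hCurd μ)]
    simp only [add_apply, FunLike.coe_smul, Pi.smul_apply, smul_eq_mul]
    ring
  have hdCur : ∀ μ κ, fderiv ℝ (Cur μ) x (E4.basisVector κ) =
      -fderiv ℝ (JN μ) x (E4.basisVector κ) + ε₀ * fderiv ℝ (P μ) x (E4.basisVector κ) := by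
    intro μ κ
    have h1 : DifferentiableAt ℝ (fun y ↦ -JN μ y) x := (hJNd μ).neg
    have h2 : DifferentiableAt ℝ (fun y ↦ ε₀ * P μ y) x := (hPd μ).const_mul ε₀
    have : Cur μ = fun y ↦ -JN μ y + ε₀ * P μ y := rfl
    rw [this, fderiv_fun_add h1 h2, fderiv_fun_neg, fderiv_const_mul (hPd μ)]
    simp only [add_apply, neg_apply, FunLike.coe_smul, Pi.smul_apply, smul_eq_mul]
  -- the divergences of `J^N` and `J^{dt*}` (the wave equation at `x` enters here, and only here)
  have hdivN : ∑ μ, fderiv ℝ (JN μ) x (E4.basisVector μ) =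
      KerrSchild.multiplierBulk (inverseMetric M a) N Φ x :=
    sum_fderiv_redShiftCurrent hMa hp hp hΦ hxr hsol
  have hdivP : ∑ μ, fderiv ℝ (P μ) x (E4.basisVector μ) = KerrSchild.deformationTerm G Φ x := by
    have h := KerrSchild.sum_fderiv_normalCurrent (B.differentiableAt_inverseMetric x)
      (B.inverseMetric_symm x) hΦ
    rw [hsol, zero_mul, zero_add] at h
    exact h
  -- assemble the divergence, term by term
  have hterm : ∀ μ, fderiv ℝ (J μ) x (E4.basisVector μ) =
      hf x * (fderiv ℝ χ x (E4.basisVector μ) * Cur μ x) +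
        χ x * (-(fderiv ℝ hf x (E4.basisVector μ) * JN μ x) +
          ε₀ * (fderiv ℝ hf x (E4.basisVector μ) * P μ x)) +
        W x * (-fderiv ℝ (JN μ) x (E4.basisVector μ) +
          ε₀ * fderiv ℝ (P μ) x (E4.basisVector μ)) := by
    intro μ
    rw [hdJ, hdW, hdCur, hWdef]
    simp only [hCur]
    ring
  have hS2 : ∑ μ, (-(fderiv ℝ hf x (E4.basisVector μ) * JN μ x) +
      ε₀ * (fderiv ℝ hf x (E4.basisVector μ) * P μ x)) =
      -(∑ μ, fderiv ℝ hf x (E4.basisVector μ) * JN μ x) +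
        ε₀ * ∑ μ, fderiv ℝ hf x (E4.basisVector μ) * P μ x := by
    rw [Finset.sum_add_distrib, Finset.sum_neg_distrib, ← Finset.mul_sum]
  have hS3 : ∑ μ, (-fderiv ℝ (JN μ) x (E4.basisVector μ) +
      ε₀ * fderiv ℝ (P μ) x (E4.basisVector μ)) =
      -KerrSchild.multiplierBulk (inverseMetric M a) N Φ x +
        ε₀ * KerrSchild.deformationTerm G Φ x := by
    rw [Finset.sum_add_distrib, Finset.sum_neg_distrib, ← Finset.mul_sum, hdivN, hdivP]
  have hsum : ∑ μ, fderiv ℝ (J μ) x (E4.basisVector μ) =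
      hf x * ∑ μ, fderiv ℝ χ x (E4.basisVector μ) * Cur μ x +
        χ x * (-(∑ μ, fderiv ℝ hf x (E4.basisVector μ) * JN μ x) +
          ε₀ * ∑ μ, fderiv ℝ hf x (E4.basisVector μ) * P μ x) +
        W x * (-KerrSchild.multiplierBulk (inverseMetric M a) N Φ x +
          ε₀ * KerrSchild.deformationTerm G Φ x) := by
    rw [Finset.sum_congr rfl fun μ _ ↦ hterm μ, Finset.sum_add_distrib, Finset.sum_add_distrib,
      ← Finset.mul_sum, ← Finset.mul_sum, ← Finset.mul_sum, hS2, hS3]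
  rw [hsum]
  -- (i) the inner-boundary fluxes have signs
  have hβ : 0 < 1 + hp * (radius a x - rPlus M a) := by
    have : 0 ≤ hp * (radius a x - rPlus M a) := mul_nonneg hp0.le (by linarith)
    linarith
  have hi1 : 0 ≤ ∑ μ, fderiv ℝ hf x (E4.basisVector μ) * JN μ x :=
    redShift_horizonFactor_flux hMa Φ hε hxr hNN hN0 hβ
  have hi2 : ∑ μ, fderiv ℝ hf x (E4.basisVector μ) * P μ x ≤ 0 :=
    horizonFactor_flux hMa Φ hε hxr
  have hi : χ x * (-(∑ μ, fderiv ℝ hf x (E4.basisVector μ) * JN μ x) +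
      ε₀ * ∑ μ, fderiv ℝ hf x (E4.basisVector μ) * P μ x) ≤ 0 := by
    refine mul_nonpos_iff.mpr (Or.inl ⟨hχ0, ?_⟩)
    have := mul_nonpos_iff.mpr (Or.inl ⟨hε₀pos.le, hi2⟩)
    linarith
  -- (ii) the cut-off error
  have hii : hf x * ∑ μ, fderiv ℝ χ x (E4.basisVector μ) * Cur μ x ≤ e x := by
    have h1 : |∑ μ, fderiv ℝ χ x (E4.basisVector μ) * Cur μ x| ≤ CJ * (V x * p2 x) := by
      calc |∑ μ, fderiv ℝ χ x (E4.basisVector μ) * Cur μ x|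
          ≤ ∑ μ, |fderiv ℝ χ x (E4.basisVector μ) * Cur μ x| := Finset.abs_sum_le_sum_abs _ _
        _ ≤ ∑ μ, |fderiv ℝ χ x (E4.basisVector μ)| * (CJ * p2 x) := by
            refine Finset.sum_le_sum fun μ _ ↦ ?_
            rw [abs_mul]
            exact mul_le_mul_of_nonneg_left (hCurK' μ) (abs_nonneg _)
        _ = CJ * (V x * p2 x) := by rw [hV, ← Finset.sum_mul]; ring
    have h2 : hf x * ∑ μ, fderiv ℝ χ x (E4.basisVector μ) * Cur μ x ≤
        |∑ μ, fderiv ℝ χ x (E4.basisVector μ) * Cur μ x| :=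
      (mul_le_mul_of_nonneg_left (le_abs_self _) hhf0).trans
        (mul_le_of_le_one_left (abs_nonneg _) hhfle)
    have h3 : CJ * (V x * p2 x) ≤ e x := by
      have h0 : 0 ≤ CJ * (V x * p2 x) := mul_nonneg hCJ0 (mul_nonneg hV0 hp2nn)
      show CJ * (V x * p2 x) ≤ 4 * CJ * (V x * p2 x)
      linarith only [h0]
    exact h2.trans (h1.trans h3)
  -- (iii) the bulk: coercivity of `K^N` and smallness of `ε₀ R`
  have hiii : W x * (-KerrSchild.multiplierBulk (inverseMetric M a) N Φ x +
      ε₀ * KerrSchild.deformationTerm G Φ x) ≤ -ℓ x := by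
    have h1 : b₁ * p2 x ≤ KerrSchild.multiplierBulk (inverseMetric M a) N Φ x := hcoer
    have h2 : |KerrSchild.deformationTerm G Φ x| ≤ 32 * (1 + B.bound) * D * p2 x :=
      B.abs_deformationTerm_le Φ x hD0 (fun μ α β ↦ hD x μ α β)
    have h3 : ε₀ * KerrSchild.deformationTerm G Φ x ≤ b₁ / 2 * p2 x := by
      calc ε₀ * KerrSchild.deformationTerm G Φ x ≤ ε₀ * (32 * (1 + B.bound) * D * p2 x) :=
            mul_le_mul_of_nonneg_left ((le_abs_self _).trans h2) hε₀pos.le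
        _ = ε₀ * (32 * (1 + B.bound) * D) * p2 x := by ring
        _ ≤ b₁ / 2 * p2 x := mul_le_mul_of_nonneg_right hε₀D hp2nn
    have h4 : -KerrSchild.multiplierBulk (inverseMetric M a) N Φ x +
        ε₀ * KerrSchild.deformationTerm G Φ x ≤ -(b₁ / 2 * p2 x) := by linarith
    calc W x * (-KerrSchild.multiplierBulk (inverseMetric M a) N Φ x +
          ε₀ * KerrSchild.deformationTerm G Φ x) ≤ W x * (-(b₁ / 2 * p2 x)) :=
          mul_le_mul_of_nonneg_left h4 hW0
      _ = -ℓ x := by simp only [hℓ]; ring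
  linarith only [hi, hii, hiii]

/-- **Exhaustion of `{h > 0}` by `{h ≥ 2/(n+1)}` under the Lebesgue integral** (the tail of the
proof of `Kerr.redShift_estimate`, DRSR arXiv:1402.7034, §13.2, the limit `ε → 0`): for jointly
continuous
`h, r : ℝ × ℝ³ → ℝ` and a jointly measurable density `f ≥ 0`, a bound `B ∈ [0, ∞]` for
`∫ 1_{2/(n+1) ≤ h(s,·), r(s,·) ≤ R₁} f(s,·) + ∫_0^s ∫ 1_{2/(n+1) ≤ h(u,·), r(u,·) ≤ R₁} f(u,·) du`
uniform in `n` bounds the same expression with the sets `{q, r ≤ R₁}`, `q ⇔ 0 < h` (monotone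
convergence in `y` and in `u`). [folklore] -/
theorem redShift_lintegral_exhaustion {h r : ℝ → E3 → ℝ} {q : ℝ → E3 → Prop}
    (hh : Continuous fun p : ℝ × E3 ↦ h p.1 p.2) (hr : Continuous fun p : ℝ × E3 ↦ r p.1 p.2)
    (hq : ∀ t y, q t y ↔ 0 < h t y) {f : ℝ → E3 → ℝ≥0∞}
    (hf : Measurable fun p : ℝ × E3 ↦ f p.1 p.2) (R₁ s : ℝ) {B : ℝ≥0∞}
    (hstep : ∀ n : ℕ, (∫⁻ y, {y | 2 * (1 / ((n : ℝ) + 1)) ≤ h s y ∧ r s y ≤ R₁}.indicator (f s) y) +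
      ∫⁻ u in Set.Ioc 0 s, ∫⁻ y,
        {y | 2 * (1 / ((n : ℝ) + 1)) ≤ h u y ∧ r u y ≤ R₁}.indicator (f u) y ≤ B) :
    (∫⁻ y, {y | q s y ∧ r s y ≤ R₁}.indicator (f s) y) +
      ∫⁻ u in Set.Ioc 0 s, ∫⁻ y, {y | q u y ∧ r u y ≤ R₁}.indicator (f u) y ≤ B := by
  -- ### notation
  set S : ℕ → ℝ → Set E3 := fun n t ↦ {y | 2 * (1 / ((n : ℝ) + 1)) ≤ h t y ∧ r t y ≤ R₁} with hS
  set T : ℝ → Set E3 := fun t ↦ {y | q t y ∧ r t y ≤ R₁} with hT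
  show (∫⁻ y, (T s).indicator (f s) y) + ∫⁻ u in Set.Ioc 0 s, ∫⁻ y, (T u).indicator (f u) y ≤ B
  have hstep' : ∀ n : ℕ, (∫⁻ y, (S n s).indicator (f s) y) +
      ∫⁻ u in Set.Ioc 0 s, ∫⁻ y, (S n u).indicator (f u) y ≤ B := hstep
  have hmemS : ∀ n t y, y ∈ S n t ↔ 2 * (1 / ((n : ℝ) + 1)) ≤ h t y ∧ r t y ≤ R₁ :=
    fun _ _ _ ↦ Iff.rfl
  have hmemT : ∀ t y, y ∈ T t ↔ q t y ∧ r t y ≤ R₁ := fun _ _ ↦ Iff.rfl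
  -- ### measurability
  have hht : ∀ t, Continuous fun y ↦ h t y := fun t ↦ hh.comp (Continuous.prodMk_right t)
  have hrt : ∀ t, Continuous fun y ↦ r t y := fun t ↦ hr.comp (Continuous.prodMk_right t)
  have hfm : ∀ t, Measurable (f t) := fun t ↦ hf.comp measurable_prodMk_left
  have hSm : ∀ n t, MeasurableSet (S n t) := fun n t ↦ by
    have h3 : S n t = {y : E3 | 2 * (1 / ((n : ℝ) + 1)) ≤ h t y} ∩ {y : E3 | r t y ≤ R₁} := by
      ext y; simp only [hmemS, Set.mem_inter_iff, Set.mem_setOf_eq]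
    rw [h3]
    exact ((isClosed_le continuous_const (hht t)).inter
      (isClosed_le (hrt t) continuous_const)).measurableSet
  have hS2c : ∀ n : ℕ, IsClosed ({p : ℝ × E3 | 2 * (1 / ((n : ℝ) + 1)) ≤ h p.1 p.2} ∩
      {p : ℝ × E3 | r p.1 p.2 ≤ R₁}) := fun n ↦
    (isClosed_le continuous_const hh).inter (isClosed_le hr continuous_const)
  have hGm : ∀ n, Measurable fun u ↦ ∫⁻ y, (S n u).indicator (f u) y := by
    intro n
    have hm := (hf.indicator (hS2c n).measurableSet).lintegral_prod_right' (ν := volume)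
    have heq : (fun u ↦ ∫⁻ y, (S n u).indicator (f u) y) = fun u : ℝ ↦ ∫⁻ y : E3,
        ({p : ℝ × E3 | 2 * (1 / ((n : ℝ) + 1)) ≤ h p.1 p.2} ∩
          {p : ℝ × E3 | r p.1 p.2 ≤ R₁}).indicator (fun p : ℝ × E3 ↦ f p.1 p.2) (u, y) := by
      funext u
      refine lintegral_congr fun y ↦ ?_
      simp only [Set.indicator_apply, hmemS, Set.mem_inter_iff, Set.mem_setOf_eq]
    rw [heq]
    exact hm
  -- ### exhaustion `n → ∞`
  have hSmono : ∀ t, Monotone fun n ↦ S n t := by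
    intro t n m hnm y hy
    rw [hmemS] at hy ⊢
    have hcast : (n : ℝ) ≤ m := Nat.cast_le.mpr hnm
    refine ⟨le_trans ?_ hy.1, hy.2⟩
    have h1 : (0 : ℝ) < (n : ℝ) + 1 := by positivity
    gcongr
  have hUnion : ∀ t, T t = ⋃ n, S n t := by
    intro t
    ext y
    rw [Set.mem_iUnion, hmemT]
    constructor
    · rintro ⟨hpos, hR⟩
      rw [hq] at hpos
      obtain ⟨n, hn⟩ := exists_nat_ge (2 / h t y)
      refine ⟨n, (hmemS n t y).2 ⟨?_, hR⟩⟩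
      have hn1 : (0 : ℝ) < (n : ℝ) + 1 := by positivity
      rw [div_le_iff₀ hpos] at hn
      rw [mul_one_div, div_le_iff₀ hn1]
      have hmul : h t y * ((n : ℝ) + 1) = (n : ℝ) * h t y + h t y := by ring
      rw [hmul]
      linarith only [hn, hpos]
    · rintro ⟨n, hn⟩
      rw [hmemS] at hn
      exact ⟨(hq t y).2 (lt_of_lt_of_le (by positivity) hn.1), hn.2⟩
  have hind : ∀ t y, (T t).indicator (f t) y = ⨆ n, (S n t).indicator (f t) y := fun t y ↦ by
    rw [hUnion t]
    exact Set.indicator_iUnion_apply rfl _ _ _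
  have hmonof : ∀ t, Monotone fun n ↦ (S n t).indicator (f t) := fun t n m hnm y ↦
    Set.indicator_le_indicator_of_subset (hSmono t hnm) (fun _ ↦ zero_le) y
  have hleafsup : ∀ t, ∫⁻ y, (T t).indicator (f t) y = ⨆ n, ∫⁻ y, (S n t).indicator (f t) y := by
    intro t
    calc ∫⁻ y, (T t).indicator (f t) y = ∫⁻ y, ⨆ n, (S n t).indicator (f t) y :=
          lintegral_congr (hind t)
      _ = ⨆ n, ∫⁻ y, (S n t).indicator (f t) y :=
          lintegral_iSup (fun n ↦ (hfm t).indicator (hSm n t)) (hmonof t)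
  have hbulksup : ∫⁻ u in Set.Ioc 0 s, ∫⁻ y, (T u).indicator (f u) y =
      ⨆ n, ∫⁻ u in Set.Ioc 0 s, ∫⁻ y, (S n u).indicator (f u) y := by
    calc ∫⁻ u in Set.Ioc 0 s, ∫⁻ y, (T u).indicator (f u) y
        = ∫⁻ u in Set.Ioc 0 s, ⨆ n, ∫⁻ y, (S n u).indicator (f u) y :=
          lintegral_congr fun u ↦ hleafsup u
      _ = ⨆ n, ∫⁻ u in Set.Ioc 0 s, ∫⁻ y, (S n u).indicator (f u) y :=
          lintegral_iSup (fun n ↦ hGm n) (fun n m hnm u ↦ lintegral_mono fun y ↦ hmonof u hnm y)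
  rw [hleafsup s, hbulksup, ENNReal.iSup_add_iSup_of_monotone]
  · exact iSup_le hstep'
  · exact fun n m hnm ↦ lintegral_mono fun y ↦ hmonof s hnm y
  · exact fun n m hnm ↦ lintegral_mono fun u ↦ lintegral_mono fun y ↦ hmonof u hnm y

end Summit.FinalStateConjecture.FinalStateConjecture.Cruxes.AdiabaticMultiKerrILED.Sketch
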